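import Mathlib
import HarnessLib
import Summits.Ventures.LatticeQCDFlow.Scaling.IdentityFlowAcceptanceCouplingStrict
import Summits.Ventures.LatticeQCDFlow.Scaling.IdentityFlowAcceptanceStrongCoupling
import Summits.Ventures.LatticeQCDFlow.Scaling.IdentityFlowHoldingTimeCouplingMonotone

/-!
# LatticeQCDFlow / Scaling — COUPLING TRANSFER of a perfectly trained flow: proposing from the
# Wilson law at `β₀` against the Wilson law at `β`, the acceptance PEAKS at `β = β₀` and falls
# monotonically (strictly, linearly to first order) on both sides; the holding time rises

HONEST FRAMING: exact (Metropolis-corrected) sampling algorithms for lattice gauge theory;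
figures of merit are autocorrelation/cost numbers at stated couplings and volumes; no
continuum-physics claim.

Venture `LatticeQCDFlow` (cell pub-lqcd), topic `Scaling`; FANOUT row 3 (`s0-u1-a`, S0-B
implementation A, GEN-17).  COROLLARIES (no new estimate) of row 3's GEN-17 laws for an ARBITRARY
reference law — `Scaling/IdentityFlowAcceptanceCouplingMonotone`, `…CouplingStrict`,
`…StrongCoupling`, `Scaling/IdentityFlowHoldingTimeCouplingMonotone` (imported) — at the reference
law `μ_{β₀} = wilsonMeasure ρ β₀` (theory-2's normalised Wilson measure; a probability measure for
continuous `ρ`, `isProbabilityMeasure_wilsonMeasure`).  NO definition is introduced.  This is the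
TRANSFER question of row 3's `Scaling/AcceptanceTransfer` (GEN-5: `2·TV`-Lipschitz transfer in the
target, Gibbs-ladder `√J` bound) in its sharpest instance: a flow trained PERFECTLY at `β₀` (its
model law IS `μ_{β₀}`), re-used as the proposal of the exact sampler at coupling `β`.  The target
density w.r.t. the proposal is `dμ_β/dμ_{β₀} = e^{−(β−β₀)S}/∫e^{−(β−β₀)S}dμ_{β₀}` — a tilt of the
proposal by `(β−β₀)·(−S)` — so every law of the untrained sampler applies with `μ = μ_{β₀}`:

* §1 **`wilsonTransfer_meanAccept_antitoneOn`** (the transferred acceptance is NON-INCREASING in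
  `β` on `[β₀, ∞)`), **`wilsonTransfer_meanAccept_monotoneOn`** (NON-DECREASING on `(−∞, β₀]`) —
  every compact `G`, continuous `ρ`, `d`, `L`, `β₀`;
* §2 `wilsonMeasure_pos_of_haar_pos` (the Wilson law charges every set product Haar charges:
  positive density, `Z < ∞`); **`wilsonTransfer_meanAccept_strictAntiOn`** — STRICT on both sides
  as soon as the Wilson action is not identically zero;
* §3 **`wilsonTransfer_one_sub_meanAccept_div_tendsto`** —
  `(1 − acc(β₀→β))/(β − β₀) → ½·∫∫ |S(U) − S(U′)| dμ_{β₀} dμ_{β₀}` as `β ↓ β₀`: the loss is LINEAR in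
  the coupling offset with slope half the Gini mean difference of the action under the training law
  (by symmetry the same slope governs `β ↑ β₀`, not separately stated);
* §4 **`wilsonTransfer_holdingTime_monotoneOn`** — the equilibrium mean holding time `E_π[1/a]`
  (row 3's `Scaling/IMHHoldingTimeESS`) of the transferred sampler is NON-DECREASING on `[β₀, ∞)`.

Reading (value-free; no number of ours is computed or implied): for an exact flow sampler whose
model is the Wilson law at its training coupling, moving the TARGET coupling away from the training
coupling in either direction can only lower the equilibrium acceptance — strictly, and linearly at
first with slope `½·E_{β₀}|S − S′|` — and lengthen the holding time; an acceptance-vs-target-coupling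
scan of a well-trained flow is therefore unimodal with its peak at the training coupling, and a scan
that is not flags training error, not physics.  NOT CLAIMED: anything for imperfectly trained flows
beyond GEN-5's `2·TV` transfer bound; the size of the slope at the cell's `(β₀, L)`; nothing
re-scored, SEALED.md untouched.
-/

noncomputable section

namespace Summit.Ventures.LatticeQCDFlow.Theory2

open MeasureTheory Real Set Filter Topology
open Literature.MathematicalPhysics.QuantumFieldTheory
open Summit.Ventures.LatticeQCDFlow.Exactness (rejCurve)

variable {d L N : ℕ} [NeZero L] {G : Type*} [Group G] [TopologicalSpace G] [IsTopologicalGroup G]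
  [CompactSpace G] [MeasurableSpace G] [BorelSpace G] (ρ : G →* Matrix (Fin N) (Fin N) ℂ)

/-! ## §1 Monotonicity of the transferred acceptance in the target coupling -/

/-- **COUPLING TRANSFER, MONOTONE ABOVE**: proposals i.i.d. from the Wilson law at the TRAINING
coupling `β₀` (a perfectly trained flow), Metropolis-corrected against the Wilson law at `β`; the
equilibrium acceptance `∫∫ min(p(U), p(U′)) dμ_{β₀} dμ_{β₀}`, `p = e^{−(β−β₀)S}/∫e^{−(β−β₀)S}dμ_{β₀}`
(the Radon–Nikodym derivative `dμ_β/dμ_{β₀}`), is NON-INCREASING in `β` on `[β₀, ∞)` — every compact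
`G`, continuous `ρ`, `d`, `L`. [ours] -/
theorem wilsonTransfer_meanAccept_antitoneOn (hρ : Continuous ρ) (β₀ : ℝ) :
    AntitoneOn (fun β : ℝ => ∫ U, ∫ U',
        min (Real.exp (-(β - β₀) * wilsonAction ρ U)
            / ∫ V, Real.exp (-(β - β₀) * wilsonAction ρ V) ∂(wilsonMeasure (d := d) (L := L) ρ β₀))
          (Real.exp (-(β - β₀) * wilsonAction ρ U')
            / ∫ V, Real.exp (-(β - β₀) * wilsonAction ρ V) ∂(wilsonMeasure (d := d) (L := L) ρ β₀))
        ∂(wilsonMeasure (d := d) (L := L) ρ β₀) ∂(wilsonMeasure (d := d) (L := L) ρ β₀)) (Ici β₀) := by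
  haveI := isProbabilityMeasure_wilsonMeasure (d := d) (L := L) (G := G) ρ hρ β₀
  have h := wilsonIdentityFlow_meanAccept_antitoneOn ρ (wilsonMeasure (d := d) (L := L) ρ β₀) hρ
  intro β hβ β' hβ' hββ'
  exact h (mem_Ici.2 (sub_nonneg.2 (mem_Ici.1 hβ))) (mem_Ici.2 (sub_nonneg.2 (mem_Ici.1 hβ')))
    (sub_le_sub_right hββ' β₀)

/-- **COUPLING TRANSFER, MONOTONE BELOW**: the same acceptance is NON-DECREASING in `β` on
`(−∞, β₀]` — it peaks (at `1`) exactly at the training coupling and falls off monotonically on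
both sides. [ours] -/
theorem wilsonTransfer_meanAccept_monotoneOn (hρ : Continuous ρ) (β₀ : ℝ) :
    MonotoneOn (fun β : ℝ => ∫ U, ∫ U',
        min (Real.exp (-(β - β₀) * wilsonAction ρ U)
            / ∫ V, Real.exp (-(β - β₀) * wilsonAction ρ V) ∂(wilsonMeasure (d := d) (L := L) ρ β₀))
          (Real.exp (-(β - β₀) * wilsonAction ρ U')
            / ∫ V, Real.exp (-(β - β₀) * wilsonAction ρ V) ∂(wilsonMeasure (d := d) (L := L) ρ β₀))
        ∂(wilsonMeasure (d := d) (L := L) ρ β₀) ∂(wilsonMeasure (d := d) (L := L) ρ β₀)) (Iic β₀) := by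
  haveI := isProbabilityMeasure_wilsonMeasure (d := d) (L := L) (G := G) ρ hρ β₀
  have h := wilsonIdentityFlow_meanAccept_monotoneOn ρ (wilsonMeasure (d := d) (L := L) ρ β₀) hρ
  intro β hβ β' hβ' hββ'
  exact h (mem_Iic.2 (sub_nonpos.2 (mem_Iic.1 hβ))) (mem_Iic.2 (sub_nonpos.2 (mem_Iic.1 hβ')))
    (sub_le_sub_right hββ' β₀)

/-! ## §2 Strictness (Wilson action not identically zero) -/

/-- The Wilson law charges every set that product Haar charges (its density `e^{−β₀S}/Z` is
everywhere positive and `Z < ∞`). [folklore] -/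
theorem wilsonMeasure_pos_of_haar_pos (hρ : Continuous ρ) (β₀ : ℝ) {A : Set (GaugeConfig d L G)}
    (hA : 0 < (Measure.pi fun _ : Edge d L => haarProbability G) A) :
    0 < wilsonMeasure (d := d) (L := L) ρ β₀ A := by
  haveI := isProbabilityMeasure_wilsonMeasure (d := d) (L := L) (G := G) ρ hρ β₀
  -- `Z ≠ ⊤`, from `μ_{β₀}(univ) = 1`
  have hZ : partitionFunction (d := d) (L := L) ρ β₀ ≠ ⊤ := by
    intro ht
    have h1 : wilsonMeasure (d := d) (L := L) ρ β₀ Set.univ = 1 := measure_univ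
    unfold wilsonMeasure at h1
    rw [Measure.smul_apply, smul_eq_mul, show wilsonWeight (d := d) (L := L) ρ β₀ Set.univ =
      partitionFunction (d := d) (L := L) ρ β₀ from rfl, ht, ENNReal.inv_top, zero_mul] at h1
    exact zero_ne_one h1
  rw [pos_iff_ne_zero] at hA ⊢
  unfold wilsonMeasure wilsonWeight
  rw [Measure.smul_apply, smul_eq_mul, mul_ne_zero_iff]
  refine ⟨ENNReal.inv_ne_zero.2 hZ, ?_⟩
  have hfm : Measurable fun U : GaugeConfig d L G =>
      ENNReal.ofReal (Real.exp (-β₀ * wilsonAction ρ U)) :=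
    ENNReal.measurable_ofReal.comp
      (Real.measurable_exp.comp ((WilsonRP.measurable_wilsonAction ρ hρ).const_mul _))
  rw [Ne, withDensity_apply_eq_zero hfm]
  rwa [show {U : GaugeConfig d L G | ENNReal.ofReal (Real.exp (-β₀ * wilsonAction ρ U)) ≠ 0} ∩ A = A
    from by
      rw [inter_eq_right]
      exact fun U _ => (ENNReal.ofReal_pos.2 (Real.exp_pos _)).ne']

/-- **COUPLING TRANSFER, STRICT**: if the Wilson action is not identically zero, the transferred
acceptance is STRICTLY decreasing on `[β₀, ∞)` and strictly increasing on `(−∞, β₀]`. [ours] -/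
theorem wilsonTransfer_meanAccept_strictAntiOn (hρ : Continuous ρ)
    (hS : ∃ U₀ : GaugeConfig d L G, wilsonAction ρ U₀ ≠ 0) (β₀ : ℝ) :
    StrictAntiOn (fun β : ℝ => ∫ U, ∫ U',
        min (Real.exp (-(β - β₀) * wilsonAction ρ U)
            / ∫ V, Real.exp (-(β - β₀) * wilsonAction ρ V) ∂(wilsonMeasure (d := d) (L := L) ρ β₀))
          (Real.exp (-(β - β₀) * wilsonAction ρ U')
            / ∫ V, Real.exp (-(β - β₀) * wilsonAction ρ V) ∂(wilsonMeasure (d := d) (L := L) ρ β₀))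
        ∂(wilsonMeasure (d := d) (L := L) ρ β₀) ∂(wilsonMeasure (d := d) (L := L) ρ β₀)) (Ici β₀)
    ∧ StrictMonoOn (fun β : ℝ => ∫ U, ∫ U',
        min (Real.exp (-(β - β₀) * wilsonAction ρ U)
            / ∫ V, Real.exp (-(β - β₀) * wilsonAction ρ V) ∂(wilsonMeasure (d := d) (L := L) ρ β₀))
          (Real.exp (-(β - β₀) * wilsonAction ρ U')
            / ∫ V, Real.exp (-(β - β₀) * wilsonAction ρ V) ∂(wilsonMeasure (d := d) (L := L) ρ β₀))
        ∂(wilsonMeasure (d := d) (L := L) ρ β₀) ∂(wilsonMeasure (d := d) (L := L) ρ β₀)) (Iic β₀) := by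
  set μ₀ : Measure (GaugeConfig d L G) := wilsonMeasure (d := d) (L := L) ρ β₀ with hμ₀
  haveI : IsProbabilityMeasure μ₀ := isProbabilityMeasure_wilsonMeasure (d := d) (L := L) (G := G) ρ hρ β₀
  have hint : ∀ γ : ℝ, Integrable (fun U : GaugeConfig d L G =>
      (1 : ℝ) * Real.exp (γ * -wilsonAction ρ U)) μ₀ := fun γ => by
    simpa only [one_mul, mul_neg, neg_mul] using integrable_exp_mul_wilsonAction ρ hρ (-γ) μ₀
  -- the two-sided levels of `T = −S`, transported from product Haar to `μ₀`
  obtain ⟨c, hc1, hc2⟩ := exists_level_neg_wilsonAction ρ hρ hS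
  have hT : ∃ c : ℝ, 0 < μ₀ {U | -wilsonAction ρ U < c} ∧ 0 < μ₀ {U | c ≤ -wilsonAction ρ U} :=
    ⟨c, wilsonMeasure_pos_of_haar_pos ρ hρ β₀ hc1, wilsonMeasure_pos_of_haar_pos ρ hρ β₀ hc2⟩
  have hT' : ∃ c : ℝ, 0 < μ₀ {U | -wilsonAction ρ U ≤ c} ∧ 0 < μ₀ {U | c < -wilsonAction ρ U} := by
    -- the level `c' = −S(U₀)/2` of `exists_level_neg_wilsonAction` also works with `≤ / <`:
    -- re-derive it for the open versions and transport
    haveI : (haarProbability G).IsOpenPosMeasure := by unfold haarProbability; infer_instance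
    obtain ⟨U₀, hU₀⟩ := hS
    have hcont : Continuous fun U : GaugeConfig d L G => -wilsonAction ρ U :=
      (continuous_wilsonAction_of_continuous ρ hρ).neg
    have h1 : -wilsonAction ρ (1 : GaugeConfig d L G) = 0 := by rw [wilsonAction_one_eq_zero, neg_zero]
    refine ⟨-wilsonAction ρ U₀ / 2, ?_, ?_⟩
    · refine wilsonMeasure_pos_of_haar_pos ρ hρ β₀ (lt_of_lt_of_le
        ((isOpen_lt hcont continuous_const).measure_pos _ ?_)
        (measure_mono fun U (hU : -wilsonAction ρ U < -wilsonAction ρ U₀ / 2) => le_of_lt hU))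
      rcases lt_or_gt_of_ne hU₀ with h | h
      · exact ⟨1, by rw [mem_setOf_eq, h1]; linarith⟩
      · exact ⟨U₀, by rw [mem_setOf_eq]; linarith⟩
    · refine wilsonMeasure_pos_of_haar_pos ρ hρ β₀ ((isOpen_lt continuous_const hcont).measure_pos _ ?_)
      rcases lt_or_gt_of_ne hU₀ with h | h
      · exact ⟨U₀, by rw [mem_setOf_eq]; linarith⟩
      · exact ⟨1, by rw [mem_setOf_eq, h1]; linarith⟩
  have hA := tiltIMH_meanAccept_strictAntiOn_of_pos (ν := μ₀) (q := fun _ => (1 : ℝ))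
    (T := fun U => -wilsonAction ρ U) measurable_const
    (WilsonRP.measurable_wilsonAction ρ hρ).neg (fun γ _ => hint γ) (fun _ => one_pos) hT
  have hM := tiltIMH_meanAccept_strictMonoOn_of_pos (ν := μ₀) (q := fun _ => (1 : ℝ))
    (T := fun U => -wilsonAction ρ U) measurable_const
    (WilsonRP.measurable_wilsonAction ρ hρ).neg (fun _ => one_pos) (fun γ _ => hint γ) hT'
  constructor
  · intro β hβ β' hβ' hββ'
    have h := hA (mem_Ici.2 (sub_nonneg.2 (mem_Ici.1 hβ))) (mem_Ici.2 (sub_nonneg.2 (mem_Ici.1 hβ')))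
      (sub_lt_sub_right hββ' β₀)
    simp only [wilsonIdentityFlow_meanAccept_eq_ratio ρ μ₀ hρ]
    exact h
  · intro β hβ β' hβ' hββ'
    have h := hM (mem_Iic.2 (sub_nonpos.2 (mem_Iic.1 hβ))) (mem_Iic.2 (sub_nonpos.2 (mem_Iic.1 hβ')))
      (sub_lt_sub_right hββ' β₀)
    simp only [wilsonIdentityFlow_meanAccept_eq_ratio ρ μ₀ hρ]
    exact h

/-! ## §3 The linear law of transfer: slope = half the Gini mean difference of the action at `β₀` -/

/-- **COUPLING TRANSFER, FIRST ORDER**: as the target coupling `β ↓ β₀`,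
`(1 − acc(β₀ → β))/(β − β₀) → ½·∫∫ |S(U) − S(U′)| dμ_{β₀} dμ_{β₀}` — a perfectly trained flow loses
acceptance LINEARLY in the coupling offset, with slope half the Gini mean difference of the action
under its own training law. [ours] -/
theorem wilsonTransfer_one_sub_meanAccept_div_tendsto (hρ : Continuous ρ) (β₀ : ℝ) :
    Tendsto (fun β : ℝ => (1 - ∫ U, ∫ U',
        min (Real.exp (-(β - β₀) * wilsonAction ρ U)
            / ∫ V, Real.exp (-(β - β₀) * wilsonAction ρ V) ∂(wilsonMeasure (d := d) (L := L) ρ β₀))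
          (Real.exp (-(β - β₀) * wilsonAction ρ U')
            / ∫ V, Real.exp (-(β - β₀) * wilsonAction ρ V) ∂(wilsonMeasure (d := d) (L := L) ρ β₀))
        ∂(wilsonMeasure (d := d) (L := L) ρ β₀) ∂(wilsonMeasure (d := d) (L := L) ρ β₀)) / (β - β₀))
      (𝓝[>] β₀) (𝓝 (1 / 2 * ∫ U, ∫ U', |wilsonAction ρ U - wilsonAction ρ U'|
        ∂(wilsonMeasure (d := d) (L := L) ρ β₀) ∂(wilsonMeasure (d := d) (L := L) ρ β₀))) := by
  haveI := isProbabilityMeasure_wilsonMeasure (d := d) (L := L) (G := G) ρ hρ β₀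
  have h := wilsonIdentityFlow_one_sub_meanAccept_div_tendsto ρ (wilsonMeasure (d := d) (L := L) ρ β₀) hρ
  -- change of variable `δ = β − β₀`
  have hsub : Tendsto (fun β : ℝ => β - β₀) (𝓝[>] β₀) (𝓝[>] 0) := by
    refine tendsto_nhdsWithin_of_tendsto_nhds_of_eventually_within _ ?_
      (eventually_nhdsWithin_of_forall fun β hβ => mem_Ioi.2 (sub_pos.2 hβ))
    have hc : Tendsto (fun β : ℝ => β - β₀) (𝓝 β₀) (𝓝 (β₀ - β₀)) :=
      (continuous_sub_right β₀).tendsto β₀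
    rw [sub_self] at hc
    exact hc.mono_left nhdsWithin_le_nhds
  exact h.comp hsub

/-! ## §4 The mean holding time of the transferred sampler -/

/-- **COUPLING TRANSFER, HOLDING TIME**: the equilibrium mean holding time `E_π[1/a]` (`τ_int + ½`
of weight-blind observables) of the sampler proposing from `μ_{β₀}` against `μ_β` is NON-DECREASING
in `β` on `[β₀, ∞)`. [ours] -/
theorem wilsonTransfer_holdingTime_monotoneOn (hρ : Continuous ρ) (β₀ : ℝ) :
    MonotoneOn (fun β : ℝ => (∫ U, Real.exp (-(β - β₀) * wilsonAction ρ U)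
        / (1 - rejCurve (wilsonMeasure (d := d) (L := L) ρ β₀)
            (fun V => Real.exp (-(β - β₀) * wilsonAction ρ V)) (fun _ => (1 : ℝ))
            (Real.exp (-(β - β₀) * wilsonAction ρ U) / 1)) ∂(wilsonMeasure (d := d) (L := L) ρ β₀))
        / ∫ V, Real.exp (-(β - β₀) * wilsonAction ρ V) ∂(wilsonMeasure (d := d) (L := L) ρ β₀))
      (Ici β₀) := by
  haveI := isProbabilityMeasure_wilsonMeasure (d := d) (L := L) (G := G) ρ hρ β₀
  have h := wilsonIdentityFlow_holdingTime_monotoneOn ρ (wilsonMeasure (d := d) (L := L) ρ β₀) hρ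
  intro β hβ β' hβ' hββ'
  exact h (mem_Ici.2 (sub_nonneg.2 (mem_Ici.1 hβ))) (mem_Ici.2 (sub_nonneg.2 (mem_Ici.1 hβ')))
    (sub_le_sub_right hββ' β₀)

end Summit.Ventures.LatticeQCDFlow.Theory2
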